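import Summits.KontsevichZagierPeriods.KontsevichZagierPeriods.Theorems.SoloBlindStuffle
import Summits.KontsevichZagierPeriods.KontsevichZagierPeriods.Theorems.SoloBlindZetaTwoSquare
import HarnessLib

/-!
# The squares chart: `η(n)`, `λ(n)` and the odd part of `ζ(n)` inside the Kontsevich–Zagier rules

For `n ≥ 2` let `B_n = [(0,1)ⁿ, 1/(1-P)]`, `P = x₀⋯x_{n-1}`, be Beukers' box for `ζ(n)`
(`SoloBlindZetaBox.boxZetaRep`), and consider the three further `ℚ`-rational boxes

* `M_n = [(0,1)ⁿ, P/(1-P²)]` (the odd part, `Σ_k P^(2k+1)`, value `2⁻ⁿζ(n)`),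
* `Λ'_n = [(0,1)ⁿ, 1/(1-P²)]` (the even part, value `λ(n) = (1-2⁻ⁿ)ζ(n)`),
* `A_n = [(0,1)ⁿ, 1/(1+P)]` (the alternating box, value `η(n) = (1-2¹⁻ⁿ)ζ(n)`).

**Inside the rules** (`Q = FormalRep/relations`): the squares chart `yᵢ = xᵢ²` (rule (2), Jacobian
`2ⁿP`) gives `[B_n] = 2ⁿ[M_n]` (`mkQ_box_eq_odd`); additivity of the integrand (rule (1)) gives
`[B_n] = [Λ'_n] + [M_n]` and `[Λ'_n] = [A_n] + [M_n]`.  Hence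
`2ⁿ[Λ'_n] = (2ⁿ-1)[B_n]` and `2ⁿ[A_n] = (2ⁿ-2)[B_n]` (`nsmul_mkQ_evenBox`, `nsmul_mkQ_altBox`):
Euler's `η(n) = (1-2¹⁻ⁿ)ζ(n)` and `λ(n) = (1-2⁻ⁿ)ζ(n)` as finite chains of moves, for every `n`.

For `n = 2` the boxes `B₂`, `A₂ = [(0,1)², 1/(1+xy)]` (`π²/12`), `Λ'₂ = [(0,1)², 1/(1-x²y²)]`
(`π²/8`) therefore lie in the `π`-sector `M_π` of `SoloBlindZetaTwoSquare`, on which the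
Kontsevich–Zagier conjecture holds (`kz_altBoxTwo`, `kz_evenBoxTwo`); their values are read off
by evaluating (`altBoxRep_two_value`, `evenBoxRep_two_value`).  The general chart lemma
`equivalent_of_sqChart` is reused for `ζ(4)` (`SoloBlindZetaFour`) and the `ζ(n)`-lines
(`SoloBlindLines`).
-/

noncomputable section

namespace Summit.KontsevichZagierPeriods.KontsevichZagierPeriods.Theorems

open Set MeasureTheory
open Literature.ModelTheory.ExponentialFields (IsSemialgebraic)
open MvPolynomial (aeval X C)
open Literature.NumberTheory.Transcendental
open Literature.NumberTheory.Transcendental.KZ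

namespace SoloBlind

variable {n : ℕ}

/-! ## The squares chart -/

/-- The squares chart `Φ(x)ᵢ = xᵢ²`. -/
def sqChart (n : ℕ) (x : Fin n → ℝ) : Fin n → ℝ := fun i => x i ^ 2

/-- Its derivative `DΦ(x) = diag(2xᵢ)`. -/
def sqDeriv (n : ℕ) (x : Fin n → ℝ) : (Fin n → ℝ) →L[ℝ] (Fin n → ℝ) :=
  ContinuousLinearMap.pi fun i =>
    (2 * x i) • ContinuousLinearMap.proj (R := ℝ) (φ := fun _ : Fin n => ℝ) i

/-- `Φ` is differentiable with derivative `sqDeriv`. -/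
theorem hasFDerivAt_sqChart (x : Fin n → ℝ) : HasFDerivAt (sqChart n) (sqDeriv n x) x := by
  rw [hasFDerivAt_pi']
  intro i
  have hrow : (ContinuousLinearMap.proj (R := ℝ) (φ := fun _ : Fin n => ℝ) i).comp (sqDeriv n x) =
      (2 * x i) • ContinuousLinearMap.proj (R := ℝ) (φ := fun _ : Fin n => ℝ) i :=
    ContinuousLinearMap.ext fun w => by simp [sqDeriv]
  rw [hrow, show (fun y : Fin n → ℝ => sqChart n y i) = fun y => y i * y i from
    funext fun y => sq (y i)]
  refine ((hasFDerivAt_apply i x).mul (hasFDerivAt_apply i x)).congr_fderiv ?_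
  ext w
  simp
  ring

/-- The matrix of `DΦ(x)` is diagonal. -/
theorem toMatrix_sqDeriv (x : Fin n → ℝ) :
    LinearMap.toMatrix' ((sqDeriv n x : (Fin n → ℝ) →L[ℝ] (Fin n → ℝ)) :
      (Fin n → ℝ) →ₗ[ℝ] (Fin n → ℝ)) = Matrix.diagonal fun i => 2 * x i := by
  ext i j
  rw [LinearMap.toMatrix'_apply, ContinuousLinearMap.coe_coe, Matrix.diagonal_apply]
  by_cases h : i = j
  · subst h; simp [sqDeriv]
  · simp [sqDeriv, h]

/-- **The Jacobian** `det DΦ(x) = 2ⁿ·x₀⋯x_{n-1}`. -/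
theorem det_sqDeriv (x : Fin n → ℝ) : (sqDeriv n x).det = 2 ^ n * ∏ i, x i := by
  rw [ContinuousLinearMap.det, ← LinearMap.det_toMatrix', toMatrix_sqDeriv, Matrix.det_diagonal,
    Finset.prod_mul_distrib, Finset.prod_const, Finset.card_univ, Fintype.card_fin]

/-- On the box the Jacobian is positive. -/
theorem abs_det_sqDeriv {x : Fin n → ℝ} (hx : x ∈ kzOpenBox n) :
    |(sqDeriv n x).det| = 2 ^ n * ∏ i, x i := by
  rw [det_sqDeriv]
  exact abs_of_pos (mul_pos (pow_pos two_pos n) (Finset.prod_pos fun i _ => (hx i).1))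

/-- `Φ` is injective on the box. -/
theorem injOn_sqChart : InjOn (sqChart n) (kzOpenBox n) := fun _ hx _ hy h => funext fun i =>
  (pow_left_inj₀ (hx i).1.le (hy i).1.le two_ne_zero).mp (congrFun h i)

/-- `Φ` maps the box onto itself. -/
theorem image_sqChart : sqChart n '' kzOpenBox n = kzOpenBox n := by
  refine Subset.antisymm (image_subset_iff.mpr fun x hx i => ?_) fun y hy => ?_
  · exact ⟨pow_pos (hx i).1 2, pow_lt_one₀ (hx i).1.le (hx i).2 two_ne_zero⟩
  · refine ⟨fun i => Real.sqrt (y i), fun i => ⟨Real.sqrt_pos.mpr (hy i).1, ?_⟩,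
      funext fun i => Real.sq_sqrt (hy i).1.le⟩
    rw [Real.sqrt_lt' one_pos, one_pow]
    exact (hy i).2

/-- `Φ` is a polynomial, hence `ℚ`-semialgebraic, map. -/
theorem isSemialgebraicMapOn_sqChart : IsSemialgebraicMapOn ℚ (kzOpenBox n) (sqChart n) :=
  IsSemialgebraicMapOn.of_forall (isSemialgebraic_kzOpenBox n) fun i =>
    (isSemialgebraicFunOn_aeval (isSemialgebraic_kzOpenBox n) (X i ^ 2)).congr fun x _ => by
      simp [sqChart]

/-- Convergence is transported along the squares chart. -/
theorem integrableOn_sqChart_iff {g : (Fin n → ℝ) → ℝ} :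
    IntegrableOn g (kzOpenBox n) ↔
      IntegrableOn (fun x => g (sqChart n x) * (2 ^ n * ∏ i, x i)) (kzOpenBox n) := by
  have h := integrableOn_iff_of_chart (measurableSet_kzOpenBox n)
    (fun x _ => hasFDerivAt_sqChart x) injOn_sqChart (fun _ hx => abs_det_sqDeriv hx)
    (g := g) (f := fun x => g (sqChart n x) * (2 ^ n * ∏ i, x i)) fun _ _ => rfl
  rwa [image_sqChart] at h

/-- **Rule (2) along the squares chart**: `[(0,1)ⁿ, g(x²)·2ⁿP] ≡ [(0,1)ⁿ, g]`. -/
theorem equivalent_of_sqChart {r r' : IntegralRep n} {g : (Fin n → ℝ) → ℝ}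
    (hrd : r.domain = kzOpenBox n)
    (hri : EqOn r.integrand (fun x => g (sqChart n x) * (2 ^ n * ∏ i, x i)) (kzOpenBox n))
    (hr'd : r'.domain = kzOpenBox n) (hr'i : EqOn r'.integrand g (kzOpenBox n)) :
    Equivalent r r' :=
  equivalent_of_chart isSemialgebraicMapOn_sqChart (fun x _ => hasFDerivAt_sqChart x)
    injOn_sqChart image_sqChart (fun _ hx => abs_det_sqDeriv hx) (fun _ _ => rfl) hrd hri hr'd
    hr'i

/-! ## The odd, even and alternating boxes -/

/-- On the box, `0 < 1 - P²`. -/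
theorem one_sub_prod_sq_pos (hn : n ≠ 0) {x : Fin n → ℝ} (hx : x ∈ kzOpenBox n) :
    0 < 1 - (∏ i, x i) ^ 2 := by
  have h := BoxIntegral.prod_mem_Ioo hn hx
  nlinarith [h.1, h.2]

/-- On the box, `0 < 1 + P`. -/
theorem one_add_prod_pos {x : Fin n → ℝ} (hx : x ∈ kzOpenBox n) : 0 < 1 + ∏ i, x i :=
  add_pos one_pos (Finset.prod_pos fun i _ => (hx i).1)

/-- The pulled-back box `2ⁿM_n = [(0,1)ⁿ, 2ⁿP/(1-P²)]` (the integrand of `B_n` along the squares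
chart times its Jacobian). -/
def oddBoxRepN (n : ℕ) (hn : 2 ≤ n) : IntegralRep n :=
  ratRep (kzOpenBox n) (fun x => (boxZetaRep n hn).integrand (sqChart n x) * (2 ^ n * ∏ i, x i))
    (2 ^ n * ∏ i, X i) (1 - ∏ i, X i ^ 2) (isSemialgebraic_kzOpenBox n)
    (fun x hx => by
      have h := one_sub_prod_sq_pos (by omega) hx
      rw [← Finset.prod_pow] at h
      simpa [map_prod] using h.ne')
    (fun x _ => by
      show 1 / (1 - ∏ i, x i ^ 2) * (2 ^ n * ∏ i, x i) = _
      simp [map_prod, div_eq_mul_inv, mul_comm, mul_assoc])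
    (integrableOn_sqChart_iff.mp (boxZetaRep n hn).integrableOn)

/-- `2ⁿM_n ≡ B_n` (one move). -/
theorem oddBoxRepN_equiv (hn : 2 ≤ n) : Equivalent (oddBoxRepN n hn) (boxZetaRep n hn) :=
  equivalent_of_sqChart rfl (fun _ _ => rfl) rfl fun _ _ => rfl

/-- The integrand of `2ⁿM_n`, unfolded. -/
theorem oddBoxRepN_integrand (hn : 2 ≤ n) (x : Fin n → ℝ) :
    (oddBoxRepN n hn).integrand x = 2 ^ n * ((∏ i, x i) / (1 - (∏ i, x i) ^ 2)) := by
  show 1 / (1 - ∏ i, x i ^ 2) * (2 ^ n * ∏ i, x i) = _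
  rw [Finset.prod_pow]
  ring

/-- **`M_n = [(0,1)ⁿ, P/(1-P²)]`**, the odd part of `B_n`. -/
def oddBoxRep (n : ℕ) (hn : 2 ≤ n) : IntegralRep n :=
  ratRep (kzOpenBox n) (fun x => (∏ i, x i) / (1 - (∏ i, x i) ^ 2)) (∏ i, X i)
    (1 - (∏ i, X i) ^ 2) (isSemialgebraic_kzOpenBox n)
    (fun x hx => by simpa [map_prod] using (one_sub_prod_sq_pos (by omega) hx).ne')
    (fun x _ => by simp [map_prod])
    (IntegrableOn.congr_fun (show IntegrableOn (fun x => 1 / 2 ^ n * (oddBoxRepN n hn).integrand x)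
        (kzOpenBox n) volume from (oddBoxRepN n hn).integrableOn.const_mul (1 / 2 ^ n))
      (fun x _ => by
        rw [oddBoxRepN_integrand, ← mul_assoc, one_div_mul_cancel (pow_ne_zero n two_ne_zero),
          one_mul])
      (measurableSet_kzOpenBox n))

/-- **`Λ'_n = [(0,1)ⁿ, 1/(1-P²)]`**, the even part of `B_n`. -/
def evenBoxRep (n : ℕ) (hn : 2 ≤ n) : IntegralRep n :=
  ratRep (kzOpenBox n) (fun x => 1 / (1 - (∏ i, x i) ^ 2)) 1 (1 - (∏ i, X i) ^ 2)
    (isSemialgebraic_kzOpenBox n)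
    (fun x hx => by simpa [map_prod] using (one_sub_prod_sq_pos (by omega) hx).ne')
    (fun x _ => by simp [map_prod])
    (IntegrableOn.congr_fun ((boxZetaRep n hn).integrableOn.sub (oddBoxRep n hn).integrableOn)
      (fun x hx => by
        have hx : x ∈ kzOpenBox n := hx
        have hP := BoxIntegral.prod_mem_Ioo (n := n) (by omega) hx
        have h1 : 1 - ∏ i, x i ≠ 0 := by linarith [hP.2]
        have h2 : 1 + ∏ i, x i ≠ 0 := by linarith [hP.1]
        show 1 / (1 - ∏ i, x i) - (∏ i, x i) / (1 - (∏ i, x i) ^ 2) = 1 / (1 - (∏ i, x i) ^ 2)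
        rw [show 1 - (∏ i, x i) ^ 2 = (1 - ∏ i, x i) * (1 + ∏ i, x i) by ring]
        field_simp
        ring)
      (measurableSet_kzOpenBox n))

/-- **`A_n = [(0,1)ⁿ, 1/(1+P)]`**, the alternating box (`η(n)`). -/
def altBoxRep (n : ℕ) (hn : 2 ≤ n) : IntegralRep n :=
  ratRep (kzOpenBox n) (fun x => 1 / (1 + ∏ i, x i)) 1 (1 + ∏ i, X i)
    (isSemialgebraic_kzOpenBox n)
    (fun x hx => by simpa [map_prod] using (one_add_prod_pos hx).ne')
    (fun x _ => by simp [map_prod])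
    (IntegrableOn.congr_fun ((evenBoxRep n hn).integrableOn.sub (oddBoxRep n hn).integrableOn)
      (fun x hx => by
        have hx : x ∈ kzOpenBox n := hx
        have hP := BoxIntegral.prod_mem_Ioo (n := n) (by omega) hx
        have h1 : 1 - ∏ i, x i ≠ 0 := by linarith [hP.2]
        have h2 : 1 + ∏ i, x i ≠ 0 := by linarith [hP.1]
        show 1 / (1 - (∏ i, x i) ^ 2) - (∏ i, x i) / (1 - (∏ i, x i) ^ 2) = 1 / (1 + ∏ i, x i)
        rw [show 1 - (∏ i, x i) ^ 2 = (1 - ∏ i, x i) * (1 + ∏ i, x i) by ring]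
        field_simp)
      (measurableSet_kzOpenBox n))

/-- All four boxes are `ℚ`-rational in KZ's literal sense. -/
theorem isRational_altBoxRep (hn : 2 ≤ n) : (altBoxRep n hn).IsRational := isRational_ratRep ..

/-- `Λ'_n` is `ℚ`-rational. -/
theorem isRational_evenBoxRep (hn : 2 ≤ n) : (evenBoxRep n hn).IsRational := isRational_ratRep ..

/-- `M_n` is `ℚ`-rational. -/
theorem isRational_oddBoxRep (hn : 2 ≤ n) : (oddBoxRep n hn).IsRational := isRational_ratRep ..

/-! ## The moves -/

/-- **Rule (1)**: `[B_n] − [Λ'_n] − [M_n] ∈ relations` (`1/(1-P) = 1/(1-P²) + P/(1-P²)`). -/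
theorem box_sub_even_sub_odd (hn : 2 ≤ n) :
    of (boxZetaRep n hn) - of (evenBoxRep n hn) - of (oddBoxRep n hn) ∈ relations := by
  refine integrandAddRel_subset_relations
    ⟨n, boxZetaRep n hn, evenBoxRep n hn, oddBoxRep n hn, rfl, rfl, fun x hx => ?_, rfl⟩
  have hx : x ∈ kzOpenBox n := hx
  have hP := BoxIntegral.prod_mem_Ioo (n := n) (by omega) hx
  have h1 : 1 - ∏ i, x i ≠ 0 := by linarith [hP.2]
  have h2 : 1 + ∏ i, x i ≠ 0 := by linarith [hP.1]
  show 1 / (1 - ∏ i, x i) = 1 / (1 - (∏ i, x i) ^ 2) + (∏ i, x i) / (1 - (∏ i, x i) ^ 2)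
  rw [show 1 - (∏ i, x i) ^ 2 = (1 - ∏ i, x i) * (1 + ∏ i, x i) by ring]
  field_simp

/-- **Rule (1)**: `[Λ'_n] − [A_n] − [M_n] ∈ relations` (`1/(1-P²) = 1/(1+P) + P/(1-P²)`). -/
theorem even_sub_alt_sub_odd (hn : 2 ≤ n) :
    of (evenBoxRep n hn) - of (altBoxRep n hn) - of (oddBoxRep n hn) ∈ relations := by
  refine integrandAddRel_subset_relations
    ⟨n, evenBoxRep n hn, altBoxRep n hn, oddBoxRep n hn, rfl, rfl, fun x hx => ?_, rfl⟩
  have hx : x ∈ kzOpenBox n := hx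
  have hP := BoxIntegral.prod_mem_Ioo (n := n) (by omega) hx
  have h1 : 1 - ∏ i, x i ≠ 0 := by linarith [hP.2]
  have h2 : 1 + ∏ i, x i ≠ 0 := by linarith [hP.1]
  show 1 / (1 - (∏ i, x i) ^ 2) = 1 / (1 + ∏ i, x i) + (∏ i, x i) / (1 - (∏ i, x i) ^ 2)
  rw [show 1 - (∏ i, x i) ^ 2 = (1 - ∏ i, x i) * (1 + ∏ i, x i) by ring]
  field_simp
  ring

/-- **Rule (1)**: `[2ⁿM_n] − Σ_{k<2ⁿ} [M_n] ∈ relations`. -/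
theorem oddBoxRepN_sub_sum (hn : 2 ≤ n) :
    of (oddBoxRepN n hn) - ∑ _k ∈ (Finset.univ : Finset (Fin (2 ^ n))), of (oddBoxRep n hn) ∈
      relations :=
  of_sub_sum_integrand_mem_relations Finset.univ (fun _ => oddBoxRep n hn) (oddBoxRepN n hn)
    (fun _ _ => rfl) fun x _ => by
      show _ = ∑ _k : Fin (2 ^ n), (oddBoxRep n hn).integrand x
      rw [oddBoxRepN_integrand, Finset.sum_const, Finset.card_univ, Fintype.card_fin, nsmul_eq_mul,
        Nat.cast_pow, Nat.cast_ofNat]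
      rfl

/-- **`[B_n] = 2ⁿ·[M_n]` in `Q`.** -/
theorem mkQ_box_eq_odd (hn : 2 ≤ n) :
    mkQ (of (boxZetaRep n hn)) = 2 ^ n • mkQ (of (oddBoxRep n hn)) := by
  rw [← mkQ_eq_mkQ_iff.mpr (oddBoxRepN_equiv hn), mkQ_eq_mkQ_iff.mpr (oddBoxRepN_sub_sum hn),
    map_sum, Finset.sum_const, Finset.card_univ, Fintype.card_fin]

/-- **`[B_n] = [Λ'_n] + [M_n]` in `Q`.** -/
theorem mkQ_box_eq_add (hn : 2 ≤ n) :
    mkQ (of (boxZetaRep n hn)) = mkQ (of (evenBoxRep n hn)) + mkQ (of (oddBoxRep n hn)) := by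
  have h : mkQ (of (boxZetaRep n hn) - of (evenBoxRep n hn)) = mkQ (of (oddBoxRep n hn)) :=
    mkQ_eq_mkQ_iff.mpr (box_sub_even_sub_odd hn)
  rwa [map_sub, sub_eq_iff_eq_add'] at h

/-- **`[Λ'_n] = [A_n] + [M_n]` in `Q`.** -/
theorem mkQ_even_eq_add (hn : 2 ≤ n) :
    mkQ (of (evenBoxRep n hn)) = mkQ (of (altBoxRep n hn)) + mkQ (of (oddBoxRep n hn)) := by
  have h : mkQ (of (evenBoxRep n hn) - of (altBoxRep n hn)) = mkQ (of (oddBoxRep n hn)) :=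
    mkQ_eq_mkQ_iff.mpr (even_sub_alt_sub_odd hn)
  rwa [map_sub, sub_eq_iff_eq_add'] at h

/-- **`λ(n) = (1-2⁻ⁿ)ζ(n)` inside the rules**: `2ⁿ[Λ'_n] = (2ⁿ-1)[B_n]` in `Q`. -/
theorem nsmul_mkQ_evenBox (hn : 2 ≤ n) :
    2 ^ n • mkQ (of (evenBoxRep n hn)) = (2 ^ n - 1) • mkQ (of (boxZetaRep n hn)) := by
  have h1 := mkQ_box_eq_odd hn
  have h2 := mkQ_box_eq_add hn
  have hN : (((2 ^ n - 1 : ℕ)) : Q) = 2 ^ n - 1 := by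
    rw [Nat.cast_sub Nat.one_le_two_pow, Nat.cast_pow, Nat.cast_ofNat, Nat.cast_one]
  simp only [nsmul_eq_mul, Nat.cast_pow, Nat.cast_ofNat] at h1 ⊢
  rw [hN]
  linear_combination h1 - (2 : Q) ^ n * h2

/-- **`η(n) = (1-2¹⁻ⁿ)ζ(n)` inside the rules**: `2ⁿ[A_n] = (2ⁿ-2)[B_n]` in `Q`. -/
theorem nsmul_mkQ_altBox (hn : 2 ≤ n) :
    2 ^ n • mkQ (of (altBoxRep n hn)) = (2 ^ n - 2) • mkQ (of (boxZetaRep n hn)) := by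
  have h1 := mkQ_box_eq_odd hn
  have h2 := mkQ_box_eq_add hn
  have h3 := mkQ_even_eq_add hn
  have h4 : 2 ≤ 2 ^ n := by
    calc (2 : ℕ) = 2 ^ 1 := (pow_one 2).symm
      _ ≤ 2 ^ n := Nat.pow_le_pow_right (by norm_num) (by omega)
  have hN : (((2 ^ n - 2 : ℕ)) : Q) = 2 ^ n - 2 := by
    rw [Nat.cast_sub h4, Nat.cast_pow, Nat.cast_ofNat]
  simp only [nsmul_eq_mul, Nat.cast_pow, Nat.cast_ofNat] at h1 ⊢
  rw [hN]
  linear_combination (2 : Q) * h1 - (2 : Q) ^ n * h2 - (2 : Q) ^ n * h3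

/-! ## Weight two: `A₂`, `Λ'₂` in the `π`-sector -/

/-- `B₂` is the unit-square representation `S` of `SoloBlindZetaTwoSquare` up to a null
reformulation of its data. -/
theorem unitSquareRep_sub_boxTwo : of unitSquareRep - of boxTwo ∈ relations := by
  have hd : unitSquareRep.domain = boxTwo.domain := by
    ext z
    show z ∈ kzUnitSquare ↔ z ∈ kzOpenBox 2
    rw [mem_kzUnitSquare, mem_kzOpenBox, Fin.forall_fin_two]
    simp only [mem_Ioo]
    tauto
  refine of_sub_of_mem_relations_of_null _ _
    (by rw [hd, Set.sdiff_self, measure_empty]) (by rw [hd, Set.sdiff_self, measure_empty])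
    fun z _ => ?_
  show 1 / (1 - z 0 * z 1) = 1 / (1 - ∏ i, z i)
  rw [Fin.prod_univ_two]

/-- **`B₂` lies in `M_π`.** -/
theorem of_boxTwo_mem_piSector : of boxTwo ∈ piSector := by
  have h : of boxTwo = of unitSquareRep - (of unitSquareRep - of boxTwo) := by abel
  rw [h]
  exact sub_mem of_unitSquareRep_mem_piSector (relations_le_piSector unitSquareRep_sub_boxTwo)

/-- `value B₂ = π²/6`, through the moves. -/
theorem boxTwo_value : boxTwo.value = Real.pi ^ 2 / 6 := by
  rw [← unitSquareRep_value]
  exact (Equivalent.value_eq_holds unitSquareRep_sub_boxTwo).symm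

/-- A class `z` with `a • z = b • [B₂]`, `a ≠ 0`, lies in `K₀[x_π]`. -/
theorem mem_adjoin_of_nsmul_eq {z : Q} {a b : ℕ} (ha : a ≠ 0) (h : a • z = b • mkQ (of boxTwo)) :
    z ∈ Algebra.adjoin K₀ {xPi} := by
  have hz : z = (a : K₀)⁻¹ • (b • mkQ (of boxTwo)) := by
    rw [← h, ← Nat.cast_smul_eq_nsmul K₀ a, inv_smul_smul₀ (Nat.cast_ne_zero.mpr ha)]
  rw [hz]
  exact Subalgebra.smul_mem _ (Subalgebra.nsmul_mem _ (mem_piSector.mp of_boxTwo_mem_piSector) _) _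

/-- **`A₂ = [(0,1)², 1/(1+xy)]` lies in `M_π`.** -/
theorem of_altBoxTwo_mem_piSector : of (altBoxRep 2 le_rfl) ∈ piSector :=
  mem_piSector.mpr (mem_adjoin_of_nsmul_eq (a := 2 ^ 2) (by norm_num) (nsmul_mkQ_altBox le_rfl))

/-- **`Λ'₂ = [(0,1)², 1/(1-x²y²)]` lies in `M_π`.** -/
theorem of_evenBoxTwo_mem_piSector : of (evenBoxRep 2 le_rfl) ∈ piSector :=
  mem_piSector.mpr (mem_adjoin_of_nsmul_eq (a := 2 ^ 2) (by norm_num) (nsmul_mkQ_evenBox le_rfl))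

/-- **The Kontsevich–Zagier conjecture for `A₂` against the `π`-sector.** -/
theorem kz_altBoxTwo {m : ℕ} (r' : IntegralRep m) (hr' : of r' ∈ piSector)
    (hv : (altBoxRep 2 le_rfl).value = r'.value) : Equivalent (altBoxRep 2 le_rfl) r' :=
  kz_piSector _ _ of_altBoxTwo_mem_piSector hr' hv

/-- **The Kontsevich–Zagier conjecture for `Λ'₂` against the `π`-sector.** -/
theorem kz_evenBoxTwo {m : ℕ} (r' : IntegralRep m) (hr' : of r' ∈ piSector)
    (hv : (evenBoxRep 2 le_rfl).value = r'.value) : Equivalent (evenBoxRep 2 le_rfl) r' :=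
  kz_piSector _ _ of_evenBoxTwo_mem_piSector hr' hv

/-- `∫∫ dxdy/(1+xy) = π²/12`, read off from the moves. -/
theorem altBoxRep_two_value : (altBoxRep 2 le_rfl).value = Real.pi ^ 2 / 12 := by
  have h := congrArg evalQ (nsmul_mkQ_altBox (n := 2) le_rfl)
  have hB : (boxZetaRep 2 le_rfl).value = Real.pi ^ 2 / 6 := boxTwo_value
  rw [map_nsmul, map_nsmul, evalQ_mkQ, evalQ_mkQ, eval_of, eval_of, hB, nsmul_eq_mul,
    nsmul_eq_mul] at h
  push_cast at h
  linarith

/-- `∫∫ dxdy/(1-x²y²) = π²/8`, read off from the moves. -/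
theorem evenBoxRep_two_value : (evenBoxRep 2 le_rfl).value = Real.pi ^ 2 / 8 := by
  have h := congrArg evalQ (nsmul_mkQ_evenBox (n := 2) le_rfl)
  have hB : (boxZetaRep 2 le_rfl).value = Real.pi ^ 2 / 6 := boxTwo_value
  rw [map_nsmul, map_nsmul, evalQ_mkQ, evalQ_mkQ, eval_of, eval_of, hB, nsmul_eq_mul,
    nsmul_eq_mul] at h
  push_cast at h
  linarith

end SoloBlind

end Summit.KontsevichZagierPeriods.KontsevichZagierPeriods.Theorems
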